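import Summits.Ventures.Crystal3D.Theorems.StickyWulffConstantTextureLiminfCellFluxSel
import Summits.Ventures.Crystal3D.Theorems.StickyWulffConstantTextureLiminfLayerCount
import HarnessLib

/-!
# The wall cell's charge against zigzag lines PLUS in-layer rows (SUM-flux domination)
# (LAYER-FLUX chain piece 4, booked cf-p1 ROUTE.md §86(72) BO; crux `TextureLiminf`, stmt-Ventures-19483)

HONEST FRAMING. Venture `Summits/Ventures/Crystal3D` (cell `crystal3d-full`), helper `--supports` the crux
`TextureLiminf` (stmt-Ventures-19483) of `route-Ventures-StickyWulffConstant`, registered line `TexShadow`.  Rung credit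
only; F-C1 not moved.  NOT the wall law: a counting inequality (charge ≤ line counts), whatever lane G can pay for.

`cell_charge_le_lines_sel` (`…CellFluxSel`) bounds the charge of a table dominated by the two plates' ZIGZAG fluxes by the
zigzag line counts.  This file adds the IN-LAYER rows (`…LayerFluxDefs`, `…LayerRows`, `…LayerCount`):

* `SumFluxDominated τ L₁ σ₁ L₂ σ₂ c` — `c i j ≤ ½ (plateFlux₁ i + layerFlux₁ + plateFlux₂ j + layerFlux₂)` (the SUM rule of
  cf-p1 §86(72) BO; the MAX rule is the sub-case `max ≤ sum`);
* `tsum_flux_add_const` — `Σ'ᵢ (aᵢ + b)|X ∩ slabᵢ| = Σ'ᵢ aᵢ|X ∩ slabᵢ| + b|X|`;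
* **`cell_charge_le_lines_comb`** — for every sum-flux-dominated `c ≥ 0` (`1/4 ≤ τ₀`):
  `2·Q_ρ(c) ≤ #T₁ + #T₂ + #T₃ + #T₄ + 160(R₀+9)(1+h)ρ`, `T₁/T₂ ⊇` the zigzag lines (selectors `step₁`, `step₂`) and
  `T₃/T₄ ⊇` the in-layer rows of the bottom/top plate with a site in `{−R₀−4 ≤ z ≤ −R₀−3} × disc ρ` resp.
  `{h+R₀+3 ≤ z ≤ h+R₀+4} × disc ρ`.
Whether lane G's payers cover BOTH families with one budget (SUM) or one (MAX) is F4's affair (19480-p2); this inequality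
holds either way.
WHAT THIS IS NOT: not the walker families; F-C1 not moved.
-/

noncomputable section

namespace Summit.Ventures.Crystal3D.Cruxes.TextureLiminf.TexShadow

/-- **the charge table `c` is SUM-FLUX-DOMINATED at steepness `τ`**: strip by strip it is at most half the sum of the two
plates' zigzag fluxes and in-layer fluxes (bottom plate toward `e₃`, top plate toward `−e₃`). -/
def SumFluxDominated (τ : ℝ) (L₁ : E3 ≃ₗᵢ[ℝ] E3) (σ₁ : ℤ → ℤ) (L₂ : E3 ≃ₗᵢ[ℝ] E3) (σ₂ : ℤ → ℤ)
    (c : ℤ → ℤ → ℝ) : Prop :=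
  ∀ i j : ℤ, c i j ≤ (plateFlux τ L₁ σ₁ e₃ i + layerFlux τ L₁ e₃ + (plateFlux τ L₂ σ₂ (-e₃) j + layerFlux τ L₂ (-e₃))) / 2

end Summit.Ventures.Crystal3D.Cruxes.TextureLiminf.TexShadow

namespace Summit.Ventures.Crystal3D.Theorems

open MeasureTheory Set
open scoped ENNReal InnerProductSpace
open Literature.MathematicalPhysics.StatisticalMechanics (IsHaggSeq triangularVec₁ triangularVec₂)
open Summit.Ventures.Crystal3D.Cruxes.TextureLiminf.TexShadow (E3 e₃ laySlab bilayerRise PlateLaunchable plateFlux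
  layerFlux layerFlux_nonneg layerFlux_le_sqrt_two FluxDominated SumFluxDominated)

/-- **Splitting a flux with a constant part:** `Σ'ᵢ (aᵢ + b)|X ∩ slabᵢ| = Σ'ᵢ aᵢ|X ∩ slabᵢ| + b|X|`
(`0 ≤ aᵢ ≤ A`, `X` measurable of finite volume). -/
theorem tsum_flux_add_const (L : E3 ≃ₗᵢ[ℝ] E3) (s : E3) (a : ℤ → ℝ) (A b : ℝ) (ha0 : ∀ i, 0 ≤ a i) (haA : ∀ i, a i ≤ A)
    (X : Set E3) (hX : MeasurableSet X) (hXfin : volume X ≠ ⊤) :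
    ∑' i : ℤ, (a i + b) * (volume (X ∩ laySlab L s i)).toReal =
      ∑' i : ℤ, a i * (volume (X ∩ laySlab L s i)).toReal + b * (volume X).toReal := by
  have hsum := measure_eq_tsum_inter_laySlab L s X hX
  have hne : ∀ i : ℤ, volume (X ∩ laySlab L s i) ≠ ⊤ := fun i => ne_top_of_le_ne_top hXfin (measure_mono Set.inter_subset_left)
  have hv : Summable fun i : ℤ => (volume (X ∩ laySlab L s i)).toReal := ENNReal.summable_toReal (by rw [← hsum]; exact hXfin)
  have hvsum : ∑' i : ℤ, (volume (X ∩ laySlab L s i)).toReal = (volume X).toReal := by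
    rw [← ENNReal.tsum_toReal_eq hne, ← hsum]
  have hav : Summable fun i : ℤ => a i * (volume (X ∩ laySlab L s i)).toReal :=
    Summable.of_nonneg_of_le (fun i => mul_nonneg (ha0 i) ENNReal.toReal_nonneg)
      (fun i => mul_le_mul_of_nonneg_right (haA i) ENNReal.toReal_nonneg) (hv.mul_left A)
  have hbv : Summable fun i : ℤ => b * (volume (X ∩ laySlab L s i)).toReal := hv.mul_left b
  calc ∑' i : ℤ, (a i + b) * (volume (X ∩ laySlab L s i)).toReal
      = ∑' i : ℤ, (a i * (volume (X ∩ laySlab L s i)).toReal + b * (volume (X ∩ laySlab L s i)).toReal) :=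
        tsum_congr fun i => by ring
    _ = ∑' i : ℤ, a i * (volume (X ∩ laySlab L s i)).toReal + ∑' i : ℤ, b * (volume (X ∩ laySlab L s i)).toReal :=
        hav.tsum_add hbv
    _ = _ := by rw [tsum_mul_left, hvsum]

set_option maxHeartbeats 400000 in
/-- **The wall cell's charge against zigzag lines plus in-layer rows.**  See the module docstring. -/
theorem cell_charge_le_lines_comb {σ₁ σ₂ : ℤ → ℤ} (hσ₁ : IsHaggSeq σ₁) (hσ₂ : IsHaggSeq σ₂)
    (L₁ L₂ : E3 ≃ₗᵢ[ℝ] E3) (s₁ s₂ : E3) (τ₀ R₀ h ρ : ℝ) (hτ₀ : 1 / 4 ≤ τ₀) (hR₀ : 1 ≤ R₀) (hh : 0 ≤ h) (hρ : 0 ≤ ρ)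
    (c : ℤ → ℤ → ℝ) (hc0 : ∀ i j, 0 ≤ c i j) (hdom : SumFluxDominated τ₀ L₁ σ₁ L₂ σ₂ c)
    {step₁ : ℤ → E3} (hsel₁ : IsZigSelector L₁ σ₁ e₃ step₁) {step₂ : ℤ → E3} (hsel₂ : IsZigSelector L₂ σ₂ (-e₃) step₂)
    (T₁ T₂ : Finset (Fin 2 → ℤ)) (T₃ T₄ : Finset (ℤ × ℤ))
    (hT₁ : ∀ t : Fin 2 → ℤ, (∃ k : ℤ,
        -R₀ - 4 ≤ (L₁ (zigVertexS step₁ k + ((t 0 : ℝ) • triangularVec₁ 1 + (t 1 : ℝ) • triangularVec₂ 1)) + s₁) 2 ∧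
        (L₁ (zigVertexS step₁ k + ((t 0 : ℝ) • triangularVec₁ 1 + (t 1 : ℝ) • triangularVec₂ 1)) + s₁) 2 ≤ -R₀ - 3 ∧
        Real.sqrt ((L₁ (zigVertexS step₁ k + ((t 0 : ℝ) • triangularVec₁ 1 + (t 1 : ℝ) • triangularVec₂ 1)) + s₁) 0 ^ 2 +
          (L₁ (zigVertexS step₁ k + ((t 0 : ℝ) • triangularVec₁ 1 + (t 1 : ℝ) • triangularVec₂ 1)) + s₁) 1 ^ 2) ≤ ρ) →
        t ∈ T₁)
    (hT₂ : ∀ t : Fin 2 → ℤ, (∃ k : ℤ,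
        h + R₀ + 3 ≤ (L₂ (zigVertexS step₂ k + ((t 0 : ℝ) • triangularVec₁ 1 + (t 1 : ℝ) • triangularVec₂ 1)) + s₂) 2 ∧
        (L₂ (zigVertexS step₂ k + ((t 0 : ℝ) • triangularVec₁ 1 + (t 1 : ℝ) • triangularVec₂ 1)) + s₂) 2 ≤ h + R₀ + 4 ∧
        Real.sqrt ((L₂ (zigVertexS step₂ k + ((t 0 : ℝ) • triangularVec₁ 1 + (t 1 : ℝ) • triangularVec₂ 1)) + s₂) 0 ^ 2 +
          (L₂ (zigVertexS step₂ k + ((t 0 : ℝ) • triangularVec₁ 1 + (t 1 : ℝ) • triangularVec₂ 1)) + s₂) 1 ^ 2) ≤ ρ) →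
        t ∈ T₂)
    (hT₃ : ∀ kj : ℤ × ℤ, (∃ i : ℤ,
        -R₀ - 4 ≤ (L₁ (layerSite σ₁ L₁ e₃ kj.1 i kj.2) + s₁) 2 ∧ (L₁ (layerSite σ₁ L₁ e₃ kj.1 i kj.2) + s₁) 2 ≤ -R₀ - 3 ∧
        Real.sqrt ((L₁ (layerSite σ₁ L₁ e₃ kj.1 i kj.2) + s₁) 0 ^ 2 + (L₁ (layerSite σ₁ L₁ e₃ kj.1 i kj.2) + s₁) 1 ^ 2) ≤ ρ) →
        kj ∈ T₃)
    (hT₄ : ∀ kj : ℤ × ℤ, (∃ i : ℤ,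
        h + R₀ + 3 ≤ (L₂ (layerSite σ₂ L₂ (-e₃) kj.1 i kj.2) + s₂) 2 ∧
        (L₂ (layerSite σ₂ L₂ (-e₃) kj.1 i kj.2) + s₂) 2 ≤ h + R₀ + 4 ∧
        Real.sqrt ((L₂ (layerSite σ₂ L₂ (-e₃) kj.1 i kj.2) + s₂) 0 ^ 2 +
          (L₂ (layerSite σ₂ L₂ (-e₃) kj.1 i kj.2) + s₂) 1 ^ 2) ≤ ρ) →
        kj ∈ T₄) :
    2 * ∑' ij : ℤ × ℤ, c ij.1 ij.2 * (volume (wallSlice ρ ∩ laySlab L₁ s₁ ij.1 ∩ laySlab L₂ s₂ ij.2)).toReal ≤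
      (T₁.card : ℝ) + T₂.card + T₃.card + T₄.card + 160 * (R₀ + 9) * (1 + h) * ρ := by
  have he₃ : ‖(e₃ : E3)‖ = 1 := by rw [e₃, PiLp.norm_single, norm_one]
  have hne₃ : ‖(-e₃ : E3)‖ = 1 := by rw [norm_neg, he₃]
  have hi₃ : ∀ p : E3, ⟪p, e₃⟫_ℝ = p 2 := fun p => by
    rw [e₃, EuclideanSpace.inner_single_right]; simp
  have hs2 : 0 ≤ Real.sqrt 2 := Real.sqrt_nonneg 2
  -- the two combined fluxes, bounded by `2√2`
  set κ₁ : ℤ → ℝ := fun i => plateFlux τ₀ L₁ σ₁ e₃ i + layerFlux τ₀ L₁ e₃ with hκ₁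
  set κ₂ : ℤ → ℝ := fun j => plateFlux τ₀ L₂ σ₂ (-e₃) j + layerFlux τ₀ L₂ (-e₃) with hκ₂
  have hκ₁0 : ∀ i, 0 ≤ κ₁ i := fun i => add_nonneg (plateFlux_nonneg τ₀ L₁ σ₁ he₃ i) (layerFlux_nonneg τ₀ L₁ e₃)
  have hκ₂0 : ∀ j, 0 ≤ κ₂ j := fun j => add_nonneg (plateFlux_nonneg τ₀ L₂ σ₂ hne₃ j) (layerFlux_nonneg τ₀ L₂ (-e₃))
  have hκ₁B : ∀ i, κ₁ i ≤ 2 * Real.sqrt 2 := fun i => by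
    have := plateFlux_le_sqrt_two τ₀ L₁ σ₁ he₃ i; have := layerFlux_le_sqrt_two τ₀ L₁ he₃; simp only [hκ₁]; linarith
  have hκ₂B : ∀ j, κ₂ j ≤ 2 * Real.sqrt 2 := fun j => by
    have := plateFlux_le_sqrt_two τ₀ L₂ σ₂ hne₃ j; have := layerFlux_le_sqrt_two τ₀ L₂ hne₃; simp only [hκ₂]; linarith
  have hdomκ : ∀ i j, c i j ≤ (κ₁ i + κ₂ j) / 2 := fun i j => by simp only [hκ₁, hκ₂]; exact hdom i j
  have hcB : ∀ i j, c i j ≤ 2 * Real.sqrt 2 := fun i j => (hdomκ i j).trans (by linarith [hκ₁B i, hκ₂B j])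
  have h418 := four_sqrt_two_pi_le
  have hπ0 := Real.pi_pos.le
  set d : ℝ := 4 * h + 4 * R₀ + 36 with hd
  have hd0 : 0 ≤ d := by rw [hd]; positivity
  have hdle : d ≤ 4 * (R₀ + 9) * (1 + h) := by rw [hd]; nlinarith
  have hT0 : (0 : ℝ) ≤ (T₁.card : ℝ) + T₂.card + T₃.card + T₄.card := by positivity
  have hSfin : ∀ r, 0 ≤ r → volume (wallSlice r) ≠ ⊤ := fun r hr => by rw [volume_wallSlice r hr]; exact ENNReal.ofReal_ne_top
  by_cases hsmall : ρ ≤ d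
  · -- degenerate: the whole slice is rim
    have h1 := two_charge_le_const L₁ L₂ s₁ s₂ c (2 * Real.sqrt 2) hc0 hcB (wallSlice ρ) (measurableSet_wallSlice ρ) (hSfin ρ hρ)
    rw [volume_wallSlice ρ hρ, ENNReal.toReal_ofReal (by positivity)] at h1
    have h2 : Real.pi * ρ ^ 2 ≤ Real.pi * (ρ * d) := mul_le_mul_of_nonneg_left (by nlinarith) hπ0
    have h3 : 2 * (2 * Real.sqrt 2) * (Real.pi * (ρ * d)) ≤ 160 * (R₀ + 9) * (1 + h) * ρ := by
      have : 2 * (2 * Real.sqrt 2) * (Real.pi * (ρ * d)) = (4 * Real.sqrt 2 * Real.pi) * d * ρ := by ring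
      rw [this]
      have h5 : (4 * Real.sqrt 2 * Real.pi) * d ≤ 18 * (4 * (R₀ + 9) * (1 + h)) := mul_le_mul h418 hdle hd0 (by norm_num)
      nlinarith
    nlinarith [mul_le_mul_of_nonneg_left h2 (by positivity : 0 ≤ 2 * (2 * Real.sqrt 2))]
  -- the shrunken slice and the annulus
  push Not at hsmall
  set ρ' : ℝ := ρ - d with hρ'
  have hρ'0 : 0 ≤ ρ' := by rw [hρ']; linarith
  have hρ'ρ : ρ' ≤ ρ := by rw [hρ']; linarith
  set S : Set E3 := wallSlice ρ with hS
  set S' : Set E3 := wallSlice ρ' with hS'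
  set ann : Set E3 := S \ S' with hann
  have hS'S : S' ⊆ S := wallSlice_mono hρ'ρ hρ'0
  have hSm : MeasurableSet S := measurableSet_wallSlice ρ
  have hS'm : MeasurableSet S' := measurableSet_wallSlice ρ'
  have hannm : MeasurableSet ann := hSm.diff hS'm
  have hannfin : volume ann ≠ ⊤ := ne_top_of_le_ne_top (hSfin ρ hρ) (measure_mono Set.sdiff_subset)
  -- split the charge
  set f : Set E3 → ℤ × ℤ → ℝ := fun X ij => c ij.1 ij.2 * (volume (X ∩ laySlab L₁ s₁ ij.1 ∩ laySlab L₂ s₂ ij.2)).toReal with hf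
  have hsplit : ∀ ij, f S ij = f S' ij + f ann ij := by
    intro ij
    simp only [hf]
    have hset : S ∩ laySlab L₁ s₁ ij.1 ∩ laySlab L₂ s₂ ij.2 =
        (S' ∩ laySlab L₁ s₁ ij.1 ∩ laySlab L₂ s₂ ij.2) ∪ (ann ∩ laySlab L₁ s₁ ij.1 ∩ laySlab L₂ s₂ ij.2) := by
      rw [← Set.union_inter_distrib_right, ← Set.union_inter_distrib_right, hann, Set.union_sdiff_cancel hS'S]
    have hdisj : Disjoint (S' ∩ laySlab L₁ s₁ ij.1 ∩ laySlab L₂ s₂ ij.2) (ann ∩ laySlab L₁ s₁ ij.1 ∩ laySlab L₂ s₂ ij.2) :=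
      (Set.disjoint_sdiff_right).mono (Set.inter_subset_left.trans Set.inter_subset_left)
        (Set.inter_subset_left.trans Set.inter_subset_left)
    rw [hset, measure_union hdisj ((hannm.inter (measurableSet_laySlab L₁ s₁ _)).inter (measurableSet_laySlab L₂ s₂ _)),
      ENNReal.toReal_add (ne_top_of_le_ne_top (hSfin ρ' hρ'0) (measure_mono (Set.inter_subset_left.trans Set.inter_subset_left)))
        (ne_top_of_le_ne_top hannfin (measure_mono (Set.inter_subset_left.trans Set.inter_subset_left))), mul_add]
  have hsumS' := summable_charge L₁ L₂ s₁ s₂ c (2 * Real.sqrt 2) hc0 hcB S' hS'm (hSfin ρ' hρ'0)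
  have hsumA := summable_charge L₁ L₂ s₁ s₂ c (2 * Real.sqrt 2) hc0 hcB ann hannm hannfin
  have hQ : ∑' ij, f S ij = ∑' ij, f S' ij + ∑' ij, f ann ij := by
    rw [← hsumS'.tsum_add hsumA]; exact tsum_congr hsplit
  -- the shrunken slice: flux, split into zigzag and in-layer parts
  have hflux := charge_le_flux L₁ L₂ s₁ s₂ κ₁ κ₂ c (2 * Real.sqrt 2) hκ₁0 hκ₁B hκ₂0 hκ₂B hc0 hdomκ S' hS'm (hSfin ρ' hρ'0)
  have hsplit₁ := tsum_flux_add_const L₁ s₁ (plateFlux τ₀ L₁ σ₁ e₃) (Real.sqrt 2) (layerFlux τ₀ L₁ e₃)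
    (plateFlux_nonneg τ₀ L₁ σ₁ he₃) (plateFlux_le_sqrt_two τ₀ L₁ σ₁ he₃) S' hS'm (hSfin ρ' hρ'0)
  have hsplit₂ := tsum_flux_add_const L₂ s₂ (plateFlux τ₀ L₂ σ₂ (-e₃)) (Real.sqrt 2) (layerFlux τ₀ L₂ (-e₃))
    (plateFlux_nonneg τ₀ L₂ σ₂ hne₃) (plateFlux_le_sqrt_two τ₀ L₂ σ₂ hne₃) S' hS'm (hSfin ρ' hρ'0)
  simp only [hκ₁, hκ₂] at hflux
  rw [hsplit₁, hsplit₂] at hflux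
  -- plate 1: zigzag lines and rows
  have hS'sub₁ : S' ⊆ {p : E3 | (0 : ℝ) ≤ ⟪p, e₃⟫_ℝ ∧ ⟪p, e₃⟫_ℝ ≤ 0 + 1 ∧ Real.sqrt (p 0 ^ 2 + p 1 ^ 2) ≤ ρ'} := by
    rintro p ⟨h1, h2, h3⟩
    refine ⟨by rw [hi₃]; exact h1, by rw [hi₃]; linarith, ?_⟩
    rw [← Real.sqrt_sq hρ'0]; exact Real.sqrt_le_sqrt h3
  have hP₁ := plate_lines_ge_flux_sel hσ₁ L₁ s₁ e₃ he₃ hsel₁ τ₀ ρ' 0 (-R₀ - 4) (by linarith) S' hS'm (hSfin ρ' hρ'0) hS'sub₁ T₁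
    (fun t ⟨k, hk1, hk2, hk3⟩ => hT₁ t ⟨k, by rw [hi₃] at hk1; linarith, by rw [hi₃] at hk2; linarith,
      hk3.trans (by rw [hρ', hd]; linarith)⟩)
  have hR₁ := layer_lines_ge_flux σ₁ L₁ s₁ e₃ he₃ τ₀ hτ₀ ρ' 0 (-R₀ - 4) (by linarith) S' hS'm hS'sub₁ T₃
    (fun kj ⟨i, hk1, hk2, hk3⟩ => hT₃ kj ⟨i, by rw [hi₃] at hk1; linarith, by rw [hi₃] at hk2; linarith,
      hk3.trans (by rw [hρ', hd]; linarith)⟩)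
  -- plate 2
  have hS'sub₂ : S' ⊆ {p : E3 | (-1 : ℝ) ≤ ⟪p, -e₃⟫_ℝ ∧ ⟪p, -e₃⟫_ℝ ≤ -1 + 1 ∧ Real.sqrt (p 0 ^ 2 + p 1 ^ 2) ≤ ρ'} := by
    rintro p ⟨h1, h2, h3⟩
    refine ⟨by rw [inner_neg_right, hi₃]; linarith, by rw [inner_neg_right, hi₃]; linarith, ?_⟩
    rw [← Real.sqrt_sq hρ'0]; exact Real.sqrt_le_sqrt h3
  have hP₂ := plate_lines_ge_flux_sel hσ₂ L₂ s₂ (-e₃) hne₃ hsel₂ τ₀ ρ' (-1) (-h - R₀ - 4) (by linarith) S' hS'm (hSfin ρ' hρ'0)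
    hS'sub₂ T₂ (fun t ⟨k, hk1, hk2, hk3⟩ => hT₂ t ⟨k, by rw [inner_neg_right, hi₃] at hk2; linarith,
      by rw [inner_neg_right, hi₃] at hk1; linarith, hk3.trans (by rw [hρ', hd]; linarith)⟩)
  have hR₂ := layer_lines_ge_flux σ₂ L₂ s₂ (-e₃) hne₃ τ₀ hτ₀ ρ' (-1) (-h - R₀ - 4) (by linarith) S' hS'm hS'sub₂ T₄
    (fun kj ⟨i, hk1, hk2, hk3⟩ => hT₄ kj ⟨i, by rw [inner_neg_right, hi₃] at hk2; linarith,
      by rw [inner_neg_right, hi₃] at hk1; linarith, hk3.trans (by rw [hρ', hd]; linarith)⟩)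
  -- the annulus
  have hA := two_charge_le_const L₁ L₂ s₁ s₂ c (2 * Real.sqrt 2) hc0 hcB ann hannm hannfin
  have hvolann : (volume ann).toReal = Real.pi * ρ ^ 2 - Real.pi * ρ' ^ 2 := by
    have hu : volume S = volume S' + volume ann := by
      rw [← measure_union (Set.disjoint_sdiff_right) hannm, Set.union_sdiff_cancel hS'S]
    rw [hS, hS', volume_wallSlice ρ hρ, volume_wallSlice ρ' hρ'0] at hu
    have h1 : volume ann = ENNReal.ofReal (Real.pi * ρ ^ 2) - ENNReal.ofReal (Real.pi * ρ' ^ 2) :=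
      (ENNReal.sub_eq_of_eq_add_rev ENNReal.ofReal_ne_top hu).symm
    rw [h1, ← ENNReal.ofReal_sub _ (by positivity), ENNReal.toReal_ofReal]
    nlinarith [mul_le_mul_of_nonneg_left (pow_le_pow_left₀ hρ'0 hρ'ρ 2) hπ0]
  have hannle : (volume ann).toReal ≤ 2 * Real.pi * ρ * d := by
    rw [hvolann, hρ']; nlinarith [mul_nonneg hπ0 (sq_nonneg d)]
  -- assemble
  have hmain : 2 * ∑' ij, f S ij ≤ (T₁.card : ℝ) + T₂.card + T₃.card + T₄.card + 2 * (2 * Real.sqrt 2) * (2 * Real.pi * ρ * d) := by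
    rw [hQ, mul_add]
    have h1 : 2 * ∑' ij, f S' ij ≤ (T₁.card : ℝ) + T₂.card + T₃.card + T₄.card := by
      simp only [hf] at hflux ⊢; linarith
    have h2 : 2 * ∑' ij, f ann ij ≤ 2 * (2 * Real.sqrt 2) * (2 * Real.pi * ρ * d) := by
      simp only [hf] at hA ⊢
      exact hA.trans (mul_le_mul_of_nonneg_left hannle (by positivity))
    linarith
  have hconst : 2 * (2 * Real.sqrt 2) * (2 * Real.pi * ρ * d) ≤ 160 * (R₀ + 9) * (1 + h) * ρ := by
    have : 2 * (2 * Real.sqrt 2) * (2 * Real.pi * ρ * d) = 2 * ((4 * Real.sqrt 2 * Real.pi) * d * ρ) := by ring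
    rw [this]
    have h5 : (4 * Real.sqrt 2 * Real.pi) * d ≤ 18 * (4 * (R₀ + 9) * (1 + h)) := mul_le_mul h418 hdle hd0 (by norm_num)
    have h6 : (4 * Real.sqrt 2 * Real.pi) * d * ρ ≤ 18 * (4 * (R₀ + 9) * (1 + h)) * ρ := mul_le_mul_of_nonneg_right h5 hρ
    have hY : 0 ≤ (R₀ + 9) * (1 + h) * ρ := mul_nonneg (mul_nonneg (by linarith) (by linarith)) hρ
    linarith only [h6, hY]
  simp only [hf] at hmain
  linarith

end Summit.Ventures.Crystal3D.Theorems

end
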